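import Summits.HodgeConjecture.HodgeConjecture.Theorems.SecondaryPeriodsLevelOneConiveauThreefoldsCurveCorrespondences
import Literature.AlgebraicGeometry.HodgeTheory.LevelOneCorrespondenceGysinLift
import Literature.AlgebraicGeometry.HodgeTheory.CurveCorrespondencePushforward
import Literature.AlgebraicGeometry.HodgeTheory.SupportedClassesGysinSpan
import Literature.AlgebraicGeometry.HodgeTheory.SupportedClassesRationalProofs

/-!
# `LevelOneConiveauThreefolds` (route `SecondaryPeriods`, crux stmt-HodgeConjecture-10376):
# the converse — GHC(3,1) IMPLIES the algebraicity of the level-one curve correspondences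

Sequel of `Theorems/SecondaryPeriodsLevelOneConiveauThreefoldsCurveCorrespondences` (where
STUB 1 ∧ STUB 2 ⟹ the crux). Here the converse direction of Grothendieck's remark (Topology 8 (1969),
p. 301; Abdulali in Kerr–Pearlstein 2016, Ch. 11, Prop. 3.2) is PROVED on the tree's carriers, with
no hypothesis: if GHC(3,1) holds for a smooth projective threefold `Y` (every rationally spanned
level-one sub-Hodge structure of `H³(Y)` is supported on a divisor), then every rational type-`(1,1)`
map `φ : H¹(C(ℂ)) → H³(Y(ℂ))` from a smooth projective curve is the action of an ALGEBRAIC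
codimension-2 class on `Y ⊗ C` — STUB 2 (`stub_curveCorrespondenceAlgebraic`) at `Y`. Hence the
registered stub is EQUIVALENT to the crux modulo STUB 1 (Riemann), i.e. genuinely crux-sized:

1. `im φ` is a rationally spanned level-one sub-Hodge structure (`exists_finset_span_eq_range`: the
   image of a rational type-`(1,1)` map; the Hodge decomposition of `H¹(C)` read in a model `B`);
2. GHC(3,1) puts it in `N¹H³(Y)`, which is spanned by Gysin images of `H¹` of smooth projective
   SURFACES `gⱼ : Sⱼ ⟶ Y` (`supportedClasses_eq_iSup_range_complexGysin`, Deligne Hodge III 8.2.8 +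
   Hironaka, both theorems of the tree; `exists_surfaces_of_span_le_supportedClasses`);
3. semisimplicity of polarisable Hodge structures lifts `φ` through `⊕ⱼ H¹(Sⱼ) → H³(Y)(1)`:
   `φ = Σⱼ (gⱼ)_* ∘ ψⱼ` with `ψⱼ : H¹(C) → H¹(Sⱼ)` rational of type `(0,0)`
   (`exists_weightOne_factorisation_of_range_le_gysin`);
4. each `ψⱼ` is the action of an algebraic divisor class on `Sⱼ ⊗ C` (Voisin I Lemma 11.41 +
   Lefschetz `(1,1)`), and `(gⱼ)_* ∘ ψⱼ = ((gⱼ × 𝟙)_* γⱼ)_*` with `(gⱼ × 𝟙)_* γⱼ` algebraic of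
   codimension 2 on `Y ⊗ C` (`exists_algebraicClass_corrAction_eq_sum_complexGysin_comp`);
5. orientation families differ by a non-zero scalar (`corrAction_eq_smul_of_orientationFamily`).

Main results: `curveCorrespondenceAlgebraic_of_range_le_supportedClasses` (pointwise in `φ`),
`curveCorrespondenceAlgebraic_of_levelOneConiveauAt` (GHC(3,1) at `Y` ⟹ STUB 2 at `Y`),
`curveCorrespondenceAlgebraic_of_levelOneConiveauThreefolds` (crux ⟹ STUB 2), and the equivalence
`levelOneConiveauThreefolds_iff_curveCorrespondenceAlgebraic_of_levelOneSpanOfCurve` (modulo STUB 1).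
-/

noncomputable section

-- `Summit.HodgeConjecture.HodgeConjecture.Theorems` is the mandated namespace (single-conjunct summit:
-- Sub = Summit), which `linter.dupNamespace` flags on every declaration; the lakefile turns the
-- linter off tree-wide (weak option), restated here so stand-alone elaboration is warning-free too.
set_option linter.dupNamespace false

open scoped Manifold
open CategoryTheory AlgebraicGeometry MonoidalCategory CartesianMonoidalCategory
open Literature.AlgebraicTopology.SingularHomology
open Literature.AlgebraicGeometry Literature.AlgebraicGeometry.Motives
open Literature.AlgebraicGeometry.HodgeTheory

namespace Summit.HodgeConjecture.HodgeConjecture.Theorems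

/-! ### 1. The image of a rational type-`(1,1)` map is a rationally spanned level-one sub-Hodge structure -/

/-- **`H¹(C(ℂ); ℂ)` is spanned by finitely many rational classes** (the images of a `ℚ`-basis of
`H¹(C(ℂ); ℚ)`; rational classes span, `span_isRationalClass_eq_top_of_isSmoothProjective_holds`).
[cite: VoisinHodgeI2002, §7.1.1] -/
theorem exists_finset_isRationalClass_span_eq_top {n : ℕ} {X : SchemeOver ℂ}
    (hX : IsSmoothProjective n X) (k : ℕ) :
    ∃ s₀ : Finset (complexBetti X k), (∀ c ∈ s₀, IsRationalClass c) ∧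
      Submodule.span ℂ (↑s₀ : Set (complexBetti X k)) = ⊤ := by
  classical
  letI := hX.chartedSpace
  haveI := ComplexPoints.compactSpace_of_isSmoothProjective hX
  haveI := ComplexPoints.t2Space_of_isSmoothProjective hX
  haveI : Module.Finite ℚ (bettiCohomology X k) :=
    finite_singularCohomology_of_compact_chartedSpace ℚ ℚ (d := 2 * n) k
  set b := Module.finBasis ℚ (bettiCohomology X k) with hb
  refine ⟨Finset.univ.image fun i ↦ ofRatClass (ComplexPoints X) k (b i), ?_, ?_⟩
  · intro c hc
    obtain ⟨i, -, rfl⟩ := Finset.mem_image.1 hc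
    exact isRationalClass_ofRatClass _
  · rw [eq_top_iff, ← span_isRationalClass_eq_top_of_isSmoothProjective_holds n X hX k, Submodule.span_le]
    intro c hc
    obtain ⟨v, rfl⟩ := (isRationalClass_iff_mem_range_ofRatClass c).1 hc
    rw [← b.linearCombination_repr v, Finsupp.linearCombination_apply, Finsupp.sum, map_sum]
    refine Submodule.sum_mem _ fun i _ ↦ ?_
    rw [Motives.ofRatClass_smul]
    exact Submodule.smul_mem _ _ (Submodule.subset_span (Finset.mem_coe.2
      (Finset.mem_image.2 ⟨i, Finset.mem_univ i, rfl⟩)))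

/-- **The image of a rational type-`(1,1)` map `φ : H¹(C(ℂ)) → H³(Y(ℂ))` is the span of a finite
set of rational classes, is sub-Hodge and has Hodge coniveau `≥ 1`** — the binder shape of the
crux. (The Hodge decomposition `H¹ = H^{1,0} ⊕ H^{0,1}` of a model `B` of `C`,
`HodgeModel.exists_sum_eq_of_hodgeDecomposition`, is mapped by `φ` into `H^{2,1} ⊕ H^{1,2}`.)
[cite: VoisinHodgeI2002, §7.3.1 Def. 7.22 and Def. 7.24] -/
theorem exists_finset_span_eq_range {Y C : SchemeOver ℂ} (hC : IsSmoothProjective 1 C)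
    (A : HodgeModel 3 Y) (B : HodgeModel 1 C) (φ : complexBetti C 1 →ₗ[ℂ] complexBetti Y 3)
    (hφ : ∀ c, IsRationalClass c → IsRationalClass (φ c))
    (hφH : ∀ (p q : ℕ), p + q = 1 → ∀ c, B.pullback 1 c ∈ B.hodgePQ 1 p q →
      A.pullback 3 (φ c) ∈ A.hodgePQ 3 (p + 1) (q + 1)) :
    ∃ s : Finset (complexBetti Y 3), (∀ c ∈ s, IsRationalClass c) ∧
      Submodule.span ℂ (↑s : Set (complexBetti Y 3)) = LinearMap.range φ ∧
      (Submodule.span ℂ (↑s : Set (complexBetti Y 3))).map (A.pullback 3).hom =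
        (⨆ (p : ℕ) (q : ℕ) (_ : p + q = 3),
          (Submodule.span ℂ (↑s : Set (complexBetti Y 3))).map (A.pullback 3).hom ⊓
            A.hodgePQ 3 p q) ∧
      (Submodule.span ℂ (↑s : Set (complexBetti Y 3))).map (A.pullback 3).hom ≤
        (⨆ (p : ℕ) (q : ℕ) (_ : p + q = 3) (_ : 1 ≤ p) (_ : 1 ≤ q), A.hodgePQ 3 p q) := by
  classical
  obtain ⟨s₀, hs₀, hspan₀⟩ := exists_finset_isRationalClass_span_eq_top hC 1
  refine ⟨s₀.image φ, ?_, ?_, ?_⟩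
  · intro c hc
    obtain ⟨c₀, hc₀, rfl⟩ := Finset.mem_image.1 hc
    exact hφ c₀ (hs₀ c₀ hc₀)
  · rw [Finset.coe_image, ← Submodule.map_span, hspan₀, Submodule.map_top]
  -- every element of `im φ`, pulled back to the model, splits into its `(2,1)` and `(1,2)` parts
  have hW : Submodule.span ℂ (↑(s₀.image φ) : Set (complexBetti Y 3)) = LinearMap.range φ := by
    rw [Finset.coe_image, ← Submodule.map_span, hspan₀, Submodule.map_top]
  have key : ∀ x ∈ (LinearMap.range φ).map (A.pullback 3).hom,
      x ∈ ⨆ (p : ℕ) (q : ℕ) (_ : p + q = 3) (_ : 1 ≤ p) (_ : 1 ≤ q),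
        (LinearMap.range φ).map (A.pullback 3).hom ⊓ A.hodgePQ 3 p q := by
    rintro _ ⟨_, ⟨c, rfl⟩, rfl⟩
    obtain ⟨z, hzc, hz⟩ := B.exists_sum_eq_of_hodgeDecomposition 1 c
    rw [← hzc, map_sum, map_sum]
    refine Submodule.sum_mem _ fun i hi ↦ ?_
    have hi' : i.1 + i.2 = 1 := Finset.HasAntidiagonal.mem_antidiagonal.1 hi
    have hmem : (A.pullback 3).hom (φ (z i)) ∈ A.hodgePQ 3 (i.1 + 1) (i.2 + 1) := hφH i.1 i.2 hi' _ (hz i hi)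
    exact Submodule.mem_iSup_of_mem (i.1 + 1) (Submodule.mem_iSup_of_mem (i.2 + 1)
      (Submodule.mem_iSup_of_mem (by omega) (Submodule.mem_iSup_of_mem (by omega)
        (Submodule.mem_iSup_of_mem (by omega) ⟨⟨φ (z i), ⟨z i, rfl⟩, rfl⟩, hmem⟩))))
  rw [hW]
  constructor
  · refine le_antisymm (fun x hx ↦ ?_) (iSup_le fun _ ↦ iSup_le fun _ ↦ iSup_le fun _ ↦ inf_le_left)
    refine (?_ : (⨆ (p : ℕ) (q : ℕ) (_ : p + q = 3) (_ : 1 ≤ p) (_ : 1 ≤ q),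
        (LinearMap.range φ).map (A.pullback 3).hom ⊓ A.hodgePQ 3 p q) ≤ _) (key x hx)
    exact iSup_mono fun p ↦ iSup_mono fun q ↦ iSup_mono fun _ ↦ iSup_le fun _ ↦ iSup_le fun _ ↦ le_rfl
  · intro x hx
    refine (?_ : (⨆ (p : ℕ) (q : ℕ) (_ : p + q = 3) (_ : 1 ≤ p) (_ : 1 ≤ q),
        (LinearMap.range φ).map (A.pullback 3).hom ⊓ A.hodgePQ 3 p q) ≤ _) (key x hx)
    exact iSup_mono fun p ↦ iSup_mono fun q ↦ iSup_mono fun _ ↦ iSup_mono fun _ ↦ iSup_mono fun _ ↦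
      inf_le_right

/-! ### 2. Supported classes of `H³` of a threefold come from `H¹` of surfaces -/

/-- **A finitely spanned `W ≤ N¹H³(Y)` of a smooth projective threefold lies in the sum of the
Gysin images `(gⱼ)_* H¹(Sⱼ(ℂ))` of finitely many morphisms `gⱼ : Sⱼ ⟶ Y` from smooth projective
SURFACES** (`exists_finite_family_of_span_le_supportedClasses`: Deligne Hodge III 8.2.8 + Hironaka,
theorems of the tree; of the resolved components, of dimensions `≤ 2`, only the surfaces carry a
degree `a` with `a + 6 = 3 + 2·dim`). [cite: DeligneHodgeIII1974, Cor. 8.2.8]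
[cite: GrothendieckTopology1969, p. 300] -/
theorem exists_surfaces_of_span_le_supportedClasses (μ : OrientationFamily) {Y : SchemeOver ℂ}
    (hY : IsSmoothProjective 3 Y) (s : Finset (complexBetti Y 3))
    (hs : Submodule.span ℂ (↑s : Set (complexBetti Y 3)) ≤ supportedClasses Y 3 1) :
    ∃ (ι : Type) (_ : Fintype ι) (S : ι → SchemeOver ℂ) (hS : ∀ j, IsSmoothProjective 2 (S j))
      (g : ∀ j, S j ⟶ Y),
      Submodule.span ℂ (↑s : Set (complexBetti Y 3)) ≤
        ⨆ j, LinearMap.range (complexGysin μ (hS j) hY (g j) (show 1 + 2 * 3 = 3 + 2 * 2 from rfl)) := by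
  classical
  obtain ⟨ι, hι, m, T, hT, g, hm, hle⟩ := exists_finite_family_of_span_le_supportedClasses μ hY s
    (fun x hx ↦ hs (Submodule.subset_span hx))
  cases nonempty_fintype ι
  -- the surfaces among the `T j`
  let ι' := {j : ι // m j = 2}
  have hS : ∀ j : ι', IsSmoothProjective 2 (T j.1) := fun j ↦ by
    have h := hT j.1
    rw [j.2] at h
    exact h
  -- a Gysin image in degree `a` from `T j` is one of the chosen ones (forces `m j = 2`, `a = 1`)
  have key : ∀ (j : ι) (a : ℕ) (hab : a + 2 * 3 = 3 + 2 * m j),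
      LinearMap.range (complexGysin μ (hT j) hY (g j) hab) ≤
        ⨆ j' : ι', LinearMap.range (complexGysin μ (hS j') hY (g j'.1)
          (show 1 + 2 * 3 = 3 + 2 * 2 from rfl)) := by
    intro j a hab
    have hmj : m j = 2 := by have := hm j; omega
    refine le_iSup_of_le ⟨j, hmj⟩ (le_of_eq ?_)
    -- transport along `m j = 2`, `a = 1`
    have aux : ∀ (m₀ : ℕ) (hm₀ : m₀ = 2) (hT₀ : IsSmoothProjective m₀ (T j)) (a₀ : ℕ)
        (hab₀ : a₀ + 2 * 3 = 3 + 2 * m₀) (hT₂ : IsSmoothProjective 2 (T j)),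
        LinearMap.range (complexGysin μ hT₀ hY (g j) hab₀) =
          LinearMap.range (complexGysin μ hT₂ hY (g j) (show 1 + 2 * 3 = 3 + 2 * 2 from rfl)) := by
      intro m₀ hm₀ hT₀ a₀ hab₀ hT₂
      subst hm₀
      obtain rfl : a₀ = 1 := by omega
      rfl
    exact aux (m j) hmj (hT j) a hab (hS ⟨j, hmj⟩)
  refine ⟨ι', inferInstance, fun j ↦ T j.1, hS, fun j ↦ g j.1, hle.trans ?_⟩
  exact iSup_le fun j ↦ iSup_le fun a ↦ iSup_le fun hab ↦ key j a hab

/-! ### 3–5. GHC(3,1) at `Y` implies STUB 2 at `Y` -/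

/-- **A rational type-`(1,1)` map `φ : H¹(C(ℂ)) → H³(Y(ℂ))` whose image is supported on a divisor
is the action of an algebraic codimension-2 class on `Y ⊗ C`**, for every orientation family.
`im φ ⊆ Σⱼ (gⱼ)_* H¹(Sⱼ)` for finitely many surfaces (`exists_surfaces_of_span_le_supportedClasses`);
`φ = Σⱼ (gⱼ)_* ∘ ψⱼ` with `ψⱼ` rational of type `(0,0)` (semisimplicity,
`exists_weightOne_factorisation_of_range_le_gysin`); `Σⱼ (gⱼ)_* ∘ ψⱼ` is the action of an
algebraic class for the complex orientations (Lefschetz `(1,1)` + pushforward,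
`exists_algebraicClass_corrAction_eq_sum_complexGysin_comp`); other orientation families rescale the
action by a non-zero scalar (`corrAction_eq_smul_of_orientationFamily`).
[cite: GrothendieckTopology1969, p. 301] [cite: KerrPearlstein2016, Ch. 11 (Abdulali) Prop. 3.2 p. 291]
[cite: VoisinHodgeI2002, §7.3.1 Lemma 7.26, Thm. 11.30 and Lemma 11.41] -/
theorem curveCorrespondenceAlgebraic_of_range_le_supportedClasses {Y C : SchemeOver ℂ}
    (hY : IsSmoothProjective 3 Y) (hC : IsSmoothProjective 1 C) (A : HodgeModel 3 Y)
    (B : HodgeModel 1 C) (φ : complexBetti C 1 →ₗ[ℂ] complexBetti Y 3)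
    (hφ : ∀ c, IsRationalClass c → IsRationalClass (φ c))
    (hφH : ∀ (p q : ℕ), p + q = 1 → ∀ c, B.pullback 1 c ∈ B.hodgePQ 1 p q →
      A.pullback 3 (φ c) ∈ A.hodgePQ 3 (p + 1) (q + 1))
    (hsupp : LinearMap.range φ ≤ supportedClasses Y 3 1) (μ : OrientationFamily) :
    ∃ γ ∈ algebraicClasses (Y ⊗ C) 2,
      corrAction μ hY hC (show 1 + 2 * 2 = 3 + 2 * 1 from rfl) γ = φ := by
  classical
  -- 1. `im φ = span s`
  obtain ⟨s, -, hspan, -, -⟩ := exists_finset_span_eq_range hC A B φ hφ hφH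
  -- 2. surfaces
  obtain ⟨ι, hι, S, hS, g, hle⟩ := exists_surfaces_of_span_le_supportedClasses complexOrientationFamily hY s
    (hspan ▸ hsupp)
  rw [hspan] at hle
  -- 3. factorisation through the Gysin morphisms
  have hA' : ∀ j, Nonempty (HodgeModel 2 (S j)) := fun j ↦ nonempty_hodgeModel_holds (hS j)
  obtain ⟨ψ, hψ, hψH, hsum⟩ := exists_weightOne_factorisation_of_range_le_gysin hY hC A B hS g
    (fun j ↦ (hA' j).some) φ hφ hφH hle
  -- 4. the algebraic class for the complex orientations
  obtain ⟨γ₀, hγ₀, hγ₀φ⟩ := exists_algebraicClass_corrAction_eq_sum_complexGysin_comp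
    complexOrientationFamily hY hC B hS g (fun j ↦ (hA' j).some) ψ hψ hψH
  rw [hsum] at hγ₀φ
  -- 5. any orientation family
  obtain ⟨c, hc, hcμ⟩ := corrAction_eq_smul_of_orientationFamily
    (OrientationFamily.hasPoincareDuality complexOrientationFamily) (OrientationFamily.hasPoincareDuality μ)
    hY hC (show 1 + 2 * 2 = 3 + 2 * 1 from rfl)
  refine ⟨c⁻¹ • γ₀, Submodule.smul_mem _ _ hγ₀, ?_⟩
  rw [map_smul, hcμ, LinearMap.smul_apply, hγ₀φ, smul_smul, inv_mul_cancel₀ hc, one_smul]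

/-- **GHC(3,1) at `Y` implies STUB 2 at `Y`.** If every rationally spanned level-one sub-Hodge
structure of `H³(Y(ℂ); ℂ)` (crux binder shape, for the Hodge model `A`) is supported on a divisor,
then every rational type-`(1,1)` map `H¹(C(ℂ)) → H³(Y(ℂ))` from a smooth projective curve is the
action of an algebraic codimension-2 class on `Y ⊗ C`. [cite: GrothendieckTopology1969, p. 301]
[cite: KerrPearlstein2016, Ch. 11 (Abdulali) Prop. 3.2 p. 291] -/
theorem curveCorrespondenceAlgebraic_of_levelOneConiveauAt {Y C : SchemeOver ℂ}
    (hY : IsSmoothProjective 3 Y) (hC : IsSmoothProjective 1 C) (A : HodgeModel 3 Y)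
    (hGHC : ∀ (s : Finset (complexBetti Y 3)), (∀ c ∈ s, IsRationalClass c) →
      (Submodule.span ℂ (↑s : Set (complexBetti Y 3))).map (A.pullback 3).hom =
        (⨆ (p : ℕ) (q : ℕ) (_ : p + q = 3),
          (Submodule.span ℂ (↑s : Set (complexBetti Y 3))).map (A.pullback 3).hom ⊓
            A.hodgePQ 3 p q) →
      (Submodule.span ℂ (↑s : Set (complexBetti Y 3))).map (A.pullback 3).hom ≤
        (⨆ (p : ℕ) (q : ℕ) (_ : p + q = 3) (_ : 1 ≤ p) (_ : 1 ≤ q), A.hodgePQ 3 p q) →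
      Submodule.span ℂ (↑s : Set (complexBetti Y 3)) ≤ supportedClasses Y 3 1)
    (B : HodgeModel 1 C) (φ : complexBetti C 1 →ₗ[ℂ] complexBetti Y 3)
    (hφ : ∀ c, IsRationalClass c → IsRationalClass (φ c))
    (hφH : ∀ (p q : ℕ), p + q = 1 → ∀ c, B.pullback 1 c ∈ B.hodgePQ 1 p q →
      A.pullback 3 (φ c) ∈ A.hodgePQ 3 (p + 1) (q + 1)) (μ : OrientationFamily) :
    ∃ γ ∈ algebraicClasses (Y ⊗ C) 2,
      corrAction μ hY hC (show 1 + 2 * 2 = 3 + 2 * 1 from rfl) γ = φ := by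
  obtain ⟨s, hs, hspan, hsub, hlev⟩ := exists_finset_span_eq_range hC A B φ hφ hφH
  exact curveCorrespondenceAlgebraic_of_range_le_supportedClasses hY hC A B φ hφ hφH
    (hspan ▸ hGHC s hs hsub hlev) μ

/-- **The crux implies STUB 2** (`stub_curveCorrespondenceAlgebraic`, statement spelled out):
GHC(3,1) for smooth projective threefolds implies that every level-one curve correspondence into
`H³` of a threefold is algebraic — unconditionally. With
`levelOneConiveauThreefolds_of_curveCorrespondences` (STUB 1 ∧ STUB 2 ⟹ crux) the registered STUB 2
is EQUIVALENT to the crux modulo STUB 1 (Riemann's theorem): it is crux-sized, not a proper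
weakening. [cite: GrothendieckTopology1969, p. 301] [cite: KerrPearlstein2016, Ch. 11 (Abdulali) Prop. 3.2 p. 291] -/
theorem curveCorrespondenceAlgebraic_of_levelOneConiveauThreefolds
    (h : Theses.SecondaryPeriods.LevelOneConiveauThreefolds)
    ⦃Y C : SchemeOver ℂ⦄ (hY : IsSmoothProjective 3 Y) (hC : IsSmoothProjective 1 C)
    (A : HodgeModel 3 Y) (B : HodgeModel 1 C) (φ : complexBetti C 1 →ₗ[ℂ] complexBetti Y 3)
    (hφ : ∀ c, IsRationalClass c → IsRationalClass (φ c))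
    (hφH : ∀ (p q : ℕ), p + q = 1 → ∀ c, B.pullback 1 c ∈ B.hodgePQ 1 p q →
      A.pullback 3 (φ c) ∈ A.hodgePQ 3 (p + 1) (q + 1)) (μ : OrientationFamily) :
    ∃ γ ∈ algebraicClasses (Y ⊗ C) 2,
      corrAction μ hY hC (show 1 + 2 * 2 = 3 + 2 * 1 from rfl) γ = φ :=
  curveCorrespondenceAlgebraic_of_levelOneConiveauAt hY hC A (fun s hs hsub hlev ↦ h hY A s hs hsub hlev)
    B φ hφ hφH μ

/-- **The crux and STUB 2 are equivalent modulo STUB 1** (Riemann's theorem in curve form for the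
level-one sub-Hodge structures of `H³` of threefolds): `LevelOneConiveauThreefolds ↔ STUB 2`
granted STUB 1. [cite: GrothendieckTopology1969, p. 301] [cite: KerrPearlstein2016, Ch. 11 (Abdulali) Prop. 3.2 p. 291] -/
theorem levelOneConiveauThreefolds_iff_curveCorrespondenceAlgebraic_of_levelOneSpanOfCurve
    (h1 : ∀ ⦃Y : SchemeOver ℂ⦄, IsSmoothProjective 3 Y → ∀ (A : HodgeModel 3 Y)
      (s : Finset (complexBetti Y 3)), (∀ c ∈ s, IsRationalClass c) →
      (Submodule.span ℂ (↑s : Set (complexBetti Y 3))).map (A.pullback 3).hom =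
        (⨆ (p : ℕ) (q : ℕ) (_ : p + q = 3),
          (Submodule.span ℂ (↑s : Set (complexBetti Y 3))).map (A.pullback 3).hom ⊓
            A.hodgePQ 3 p q) →
      (Submodule.span ℂ (↑s : Set (complexBetti Y 3))).map (A.pullback 3).hom ≤
        (⨆ (p : ℕ) (q : ℕ) (_ : p + q = 3) (_ : 1 ≤ p) (_ : 1 ≤ q), A.hodgePQ 3 p q) →
      ∃ (C : SchemeOver ℂ) (_ : IsSmoothProjective 1 C) (B : HodgeModel 1 C)
        (φ : complexBetti C 1 →ₗ[ℂ] complexBetti Y 3),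
        (∀ c, IsRationalClass c → IsRationalClass (φ c)) ∧
        (∀ (p q : ℕ), p + q = 1 → ∀ c, B.pullback 1 c ∈ B.hodgePQ 1 p q →
          A.pullback 3 (φ c) ∈ A.hodgePQ 3 (p + 1) (q + 1)) ∧
        LinearMap.range φ = Submodule.span ℂ (↑s : Set (complexBetti Y 3))) :
    Theses.SecondaryPeriods.LevelOneConiveauThreefolds ↔
      ∀ ⦃Y C : SchemeOver ℂ⦄ (hY : IsSmoothProjective 3 Y) (hC : IsSmoothProjective 1 C)
        (A : HodgeModel 3 Y) (B : HodgeModel 1 C) (φ : complexBetti C 1 →ₗ[ℂ] complexBetti Y 3),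
        (∀ c, IsRationalClass c → IsRationalClass (φ c)) →
        (∀ (p q : ℕ), p + q = 1 → ∀ c, B.pullback 1 c ∈ B.hodgePQ 1 p q →
          A.pullback 3 (φ c) ∈ A.hodgePQ 3 (p + 1) (q + 1)) →
        ∀ (μ : OrientationFamily), ∃ γ ∈ algebraicClasses (Y ⊗ C) 2,
          corrAction μ hY hC (show 1 + 2 * 2 = 3 + 2 * 1 from rfl) γ = φ :=
  ⟨fun h ↦ curveCorrespondenceAlgebraic_of_levelOneConiveauThreefolds h,
    fun h2 ↦ levelOneConiveauThreefolds_of_curveCorrespondences h1 h2⟩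

/-- **Negative side: a non-algebraic level-one curve correspondence refutes GHC(3,1).** If some
rational type-`(1,1)` map `H¹(C(ℂ)) → H³(Y(ℂ))` is, for some orientation family, NOT the action of
an algebraic codimension-2 class on `Y ⊗ C`, then `ConiveauOneFailure` holds (the route's bet),
unconditionally. [cite: GrothendieckTopology1969, p. 301] -/
theorem coniveauOneFailure_of_not_curveCorrespondenceAlgebraic {Y C : SchemeOver ℂ}
    (hY : IsSmoothProjective 3 Y) (hC : IsSmoothProjective 1 C) (A : HodgeModel 3 Y)
    (B : HodgeModel 1 C) (φ : complexBetti C 1 →ₗ[ℂ] complexBetti Y 3)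
    (hφ : ∀ c, IsRationalClass c → IsRationalClass (φ c))
    (hφH : ∀ (p q : ℕ), p + q = 1 → ∀ c, B.pullback 1 c ∈ B.hodgePQ 1 p q →
      A.pullback 3 (φ c) ∈ A.hodgePQ 3 (p + 1) (q + 1)) (μ : OrientationFamily)
    (hnot : ¬ ∃ γ ∈ algebraicClasses (Y ⊗ C) 2,
      corrAction μ hY hC (show 1 + 2 * 2 = 3 + 2 * 1 from rfl) γ = φ) :
    Theses.SecondaryPeriods.ConiveauOneFailure :=
  fun h ↦ hnot (curveCorrespondenceAlgebraic_of_levelOneConiveauThreefolds h hY hC A B φ hφ hφH μ)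

/-! ### Registered sub-goal of the crux (line `registered`): the converse, in pure-signature form -/

/-- **Registered sub-goal `stub_converse_curveCorrespondenceAlgebraic` of crux stmt-HodgeConjecture-10376**
(line `registered`): `LevelOneConiveauThreefolds` → STUB 2 (verbatim binder shape), unconditionally — the
registered STUB 2 is crux-sized (proved by `curveCorrespondenceAlgebraic_of_levelOneConiveauThreefolds`).
[cite: GrothendieckTopology1969, p. 301] [cite: KerrPearlstein2016, Ch. 11 (Abdulali) Prop. 3.2 p. 291] -/
theorem stub_converse_curveCorrespondenceAlgebraic : Summit.HodgeConjecture.HodgeConjecture.Theses.SecondaryPeriods.LevelOneConiveauThreefolds → ∀ ⦃Y C : Motives.SchemeOver ℂ⦄ (hY : Motives.IsSmoothProjective 3 Y) (hC : Motives.IsSmoothProjective 1 C) (A : HodgeModel 3 Y) (B : HodgeModel 1 C) (φ : complexBetti C 1 →ₗ[ℂ] complexBetti Y 3), (∀ c, IsRationalClass c → IsRationalClass (φ c)) → (∀ (p q : ℕ), p + q = 1 → ∀ c, B.pullback 1 c ∈ B.hodgePQ 1 p q → A.pullback 3 (φ c) ∈ A.hodgePQ 3 (p + 1) (q + 1)) →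 ∀ (μ : OrientationFamily), ∃ γ ∈ algebraicClasses (Y ⊗ C) 2, corrAction μ hY hC (show 1 + 2 * 2 = 3 + 2 * 1 from rfl) γ = φ :=
  curveCorrespondenceAlgebraic_of_levelOneConiveauThreefolds

end Summit.HodgeConjecture.HodgeConjecture.Theorems

end
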